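import Mathlib
import Summits.Ventures.PercRepro2.Defs
import Summits.Ventures.PercRepro2.Independence
import Summits.Ventures.PercRepro2.Exploration
import Summits.Ventures.PercRepro2.Frontier
import Summits.Ventures.PercRepro2.CoinDefs
import Summits.Ventures.PercRepro2.CoinInduced

/-!
# Exploring the in-coins of a vertex set in a coin system (blind cell PercRepro2, night-2)

The directed counterpart of `Frontier.lean`: the backward exploration of the arcs INTO `Z`.

* the in-frontier `frontierC arcs U Z ω` is `∪`-additive and `∩`-subadditive in `ω` and determined
  by the in-coins `intoC arcs Z`; the in-coins of `Z` and the coins inside `U ∖ Z` are disjoint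
  (for EVERY coin system — an arc into `Z` has its head in `Z`);
* the **pointwise domain Markov identity** `QEventC_inter_REventC_union_eq` (for `SameEnds` coin
  systems, `s ∉ Z`): `Q^U_C ∩ R^U_{W ∪ Z} = {ω | ω ∈ Q^{U∖Z}_C ∩ R^{U∖Z}_{W ∪ frontierC ω}}` —
  a directed path from `s` into `Z` enters `Z` through a vertex of the in-frontier reached inside
  `D[U ∖ Z]`, and every path avoiding `Z` lives in `D[U ∖ Z]` (`SameEnds` is what makes a coin
  carrying an arc of `D[U ∖ Z]` a coin inside `U ∖ Z`);
* the **tower identity** `prob_QEventC_inter_REventC_union`: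
  `P(Q^U_C ∩ R^U_{W∪Z}) = ∑_ω weight p ω · P(Q^{U∖Z}_C ∩ R^{U∖Z}_{W ∪ frontierC ω})`
  (`prob_tower` of `Frontier.lean`, model-free).
-/

namespace Summit.Ventures.PercRepro2.Coin

/-! ## The in-frontier of `Z` -/

section Frontier

variable {V : Type*} {E : Type*} [Fintype E] [DecidableEq V] {arcs : E → Finset (V × V)}
  {U Z : Finset V}

/-- The in-frontier is `∪`-additive: `S(ω ⊔ ω') = S(ω) ∪ S(ω')`. -/
lemma frontierC_sup (ω ω' : Config E) :
    frontierC arcs U Z (ω ⊔ ω') = frontierC arcs U Z ω ∪ frontierC arcs U Z ω' := by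
  ext y
  simp only [mem_frontierC, Finset.mem_union, sup_apply_eq_true_iff']
  constructor
  · rintro ⟨hy, e, (he | he), z, hz, harc⟩
    · exact Or.inl ⟨hy, e, he, z, hz, harc⟩
    · exact Or.inr ⟨hy, e, he, z, hz, harc⟩
  · rintro (⟨hy, e, he, z, hz, harc⟩ | ⟨hy, e, he, z, hz, harc⟩)
    · exact ⟨hy, e, Or.inl he, z, hz, harc⟩
    · exact ⟨hy, e, Or.inr he, z, hz, harc⟩

/-- The in-frontier is `∩`-subadditive: `S(ω ⊓ ω') ⊆ S(ω) ∩ S(ω')`. -/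
lemma frontierC_inf_subset (ω ω' : Config E) :
    frontierC arcs U Z (ω ⊓ ω') ⊆ frontierC arcs U Z ω ∩ frontierC arcs U Z ω' := by
  intro y hy
  rw [Finset.mem_inter]
  rw [mem_frontierC] at hy ⊢
  obtain ⟨hy, e, he, z, hz, harc⟩ := hy
  rw [inf_apply_eq_true_iff'] at he
  exact ⟨⟨hy, e, he.1, z, hz, harc⟩, mem_frontierC.2 ⟨hy, e, he.2, z, hz, harc⟩⟩

/-- The in-frontier is determined by the in-coins of `Z`. -/
lemma dependsOn_frontierC (arcs : E → Finset (V × V)) (U Z : Finset V) :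
    DependsOn (frontierC arcs U Z) (intoC arcs (↑Z)) := by
  intro ω ω' h
  ext y
  simp only [mem_frontierC]
  constructor
  · rintro ⟨hy, e, he, z, hz, harc⟩
    refine ⟨hy, e, ?_, z, hz, harc⟩
    rw [← h e ⟨(y, z), harc, Finset.mem_coe.2 hz⟩]
    exact he
  · rintro ⟨hy, e, he, z, hz, harc⟩
    refine ⟨hy, e, ?_, z, hz, harc⟩
    rw [h e ⟨(y, z), harc, Finset.mem_coe.2 hz⟩]
    exact he

omit [Fintype E] in
/-- The in-coins of `Z` and the coins inside `U ∖ Z` are disjoint (an arc into `Z` has its head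
in `Z`; no hypothesis on the coin system). -/
lemma disjoint_intoC_withinC_sdiff (arcs : E → Finset (V × V)) (U Z : Finset V) :
    Disjoint (intoC arcs (↑Z)) (withinC arcs (↑(U \ Z))) := by
  rw [Set.disjoint_left]
  rintro e ⟨xy, hxy, hz⟩ hw
  have := (hw xy hxy).2
  rw [Finset.mem_coe, Finset.mem_sdiff] at this
  exact this.2 (Finset.mem_coe.1 hz)

end Frontier

/-! ## The pointwise domain Markov identity -/

section DMP

variable {V : Type*} {E : Type*} [Fintype E] [DecidableEq V] {arcs : E → Finset (V × V)}

omit [Fintype E] in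
/-- On `{s ↛ Z in D[U]}`, reachability from `s` in `D[U]` is reachability in `D[U ∖ Z]`
(`SameEnds`). -/
lemma reach_inducedC_sdiff_of_reach (hS : SameEnds arcs) {U Z : Finset V} {ω : Config E} {s c : V}
    (hR : ∀ z ∈ Z, ¬ Reach arcs (inducedC arcs (↑U) ω) s z)
    (h : Reach arcs (inducedC arcs (↑U) ω) s c) :
    Reach arcs (inducedC arcs (↑(U \ Z)) ω) s c := by
  induction h with
  | refl => exact reach_refl _ _ _
  | tail hpre hstep ih =>
    rename_i x y
    have hxyU := mem_and_mem_of_openArc_inducedC hstep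
    have hxZ : x ∉ Z := fun hxZ => hR x hxZ hpre
    have hyZ : y ∉ Z := fun hyZ =>
      hR y hyZ (Relation.ReflTransGen.tail hpre hstep)
    have hx' : x ∈ (↑(U \ Z) : Set V) := by
      rw [Finset.mem_coe, Finset.mem_sdiff]; exact ⟨Finset.mem_coe.1 hxyU.1, hxZ⟩
    have hy' : y ∈ (↑(U \ Z) : Set V) := by
      rw [Finset.mem_coe, Finset.mem_sdiff]; exact ⟨Finset.mem_coe.1 hxyU.2, hyZ⟩
    exact Relation.ReflTransGen.tail ih
      (openArc_inducedC_of_openArc hS (openArc_of_openArc_inducedC hstep) hx' hy')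

/-- If `s` avoids `Z ⊆ U` in `D[U]`, it avoids the in-frontier of `Z` in `D[U ∖ Z]`
(`SameEnds`). -/
lemma not_reach_frontierC_of_not_reach (hS : SameEnds arcs) {U Z : Finset V} (hZU : Z ⊆ U)
    {ω : Config E} {s : V} (hR : ∀ z ∈ Z, ¬ Reach arcs (inducedC arcs (↑U) ω) s z) :
    ∀ y ∈ frontierC arcs U Z ω, ¬ Reach arcs (inducedC arcs (↑(U \ Z)) ω) s y := by
  intro y hy hc
  obtain ⟨⟨hyU, _⟩, e, he, z, hz, harc⟩ := mem_frontierC.1 hy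
  apply hR z hz
  have hsy : Reach arcs (inducedC arcs (↑U) ω) s y :=
    reach_mono (inducedC_mono_set (Finset.coe_subset.2 Finset.sdiff_subset) ω) hc
  refine Relation.ReflTransGen.tail hsy ?_
  exact openArc_inducedC_of_openArc hS ⟨e, he, harc⟩ (Finset.mem_coe.2 hyU)
    (Finset.mem_coe.2 (hZU hz))

/-- If `s ∉ Z` avoids the in-frontier of `Z` in `D[U ∖ Z]`, it avoids `Z` in `D[U]`
(`SameEnds`). -/
lemma not_reach_of_not_reach_frontierC (hS : SameEnds arcs) {U Z : Finset V} {ω : Config E}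
    {s : V} (hsZ : s ∉ Z)
    (hF : ∀ y ∈ frontierC arcs U Z ω, ¬ Reach arcs (inducedC arcs (↑(U \ Z)) ω) s y) :
    ∀ z ∈ Z, ¬ Reach arcs (inducedC arcs (↑U) ω) s z := by
  -- invariant along a path in `D[U]`: the vertex is outside `Z` and reached inside `D[U ∖ Z]`
  have key : ∀ {v : V}, Reach arcs (inducedC arcs (↑U) ω) s v →
      v ∉ Z ∧ Reach arcs (inducedC arcs (↑(U \ Z)) ω) s v := by
    intro v hv
    induction hv with
    | refl => exact ⟨hsZ, reach_refl _ _ _⟩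
    | tail _hpre hstep ih =>
      rename_i x y
      obtain ⟨hxZ, hx⟩ := ih
      have hxyU := mem_and_mem_of_openArc_inducedC hstep
      obtain ⟨e, he, harc⟩ := openArc_of_openArc_inducedC hstep
      by_cases hyZ : y ∈ Z
      · exfalso
        exact hF x (mem_frontierC.2 ⟨⟨Finset.mem_coe.1 hxyU.1, hxZ⟩, e, he, y, hyZ, harc⟩) hx
      · refine ⟨hyZ, Relation.ReflTransGen.tail hx ?_⟩
        have hx' : x ∈ (↑(U \ Z) : Set V) := by
          rw [Finset.mem_coe, Finset.mem_sdiff]; exact ⟨Finset.mem_coe.1 hxyU.1, hxZ⟩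
        have hy' : y ∈ (↑(U \ Z) : Set V) := by
          rw [Finset.mem_coe, Finset.mem_sdiff]; exact ⟨Finset.mem_coe.1 hxyU.2, hyZ⟩
        exact openArc_inducedC_of_openArc hS ⟨e, he, harc⟩ hx' hy'
  intro z hz hc
  exact (key hc).1 hz

/-- **Pointwise domain Markov identity** (van den Berg–Kahn (4), directed): for a `SameEnds` coin
system and `s ∉ Z ⊆ U`,
`Q^U_C ∩ R^U_{W ∪ Z} = {ω | ω ∈ Q^{U∖Z}_C ∩ R^{U∖Z}_{W ∪ frontierC ω}}`. -/
theorem QEventC_inter_REventC_union_eq (hS : SameEnds arcs) {U Z : Finset V} (hZU : Z ⊆ U) {s : V}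
    (hsZ : s ∉ Z) (C W : Finset V) :
    QEventC arcs U s C ∩ REventC arcs U s (W ∪ Z) =
      {ω | ω ∈ QEventC arcs (U \ Z) s C ∩ REventC arcs (U \ Z) s (W ∪ frontierC arcs U Z ω)} := by
  ext ω
  simp only [Set.mem_inter_iff, Set.mem_setOf_eq, mem_QEventC, mem_REventC,
    Finset.forall_mem_union]
  have hmono : ∀ {x : V}, Reach arcs (inducedC arcs (↑(U \ Z)) ω) s x →
      Reach arcs (inducedC arcs (↑U) ω) s x :=
    fun hc => reach_mono (inducedC_mono_set (Finset.coe_subset.2 Finset.sdiff_subset) ω) hc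
  constructor
  · rintro ⟨hQ, hW, hZ⟩
    exact ⟨fun c hc => reach_inducedC_sdiff_of_reach hS hZ (hQ c hc),
      fun w hw hcw => hW w hw (hmono hcw), not_reach_frontierC_of_not_reach hS hZU hZ⟩
  · rintro ⟨hQ, hW, hF⟩
    have hZ : ∀ z ∈ Z, ¬ Reach arcs (inducedC arcs (↑U) ω) s z :=
      not_reach_of_not_reach_frontierC hS hsZ hF
    exact ⟨fun c hc => hmono (hQ c hc),
      fun w hw hcw => hW w hw (reach_inducedC_sdiff_of_reach hS hZ hcw), hZ⟩

end DMP

/-! ## The tower identity -/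

section Tower

variable {V : Type*} {E : Type*} [Fintype E] [DecidableEq E] [Fintype V] [DecidableEq V]
  {R : Type*} [CommRing R]

/-- **Domain Markov identity in probability** (van den Berg–Kahn (4), summed over the values of
the in-frontier): for a `SameEnds` coin system and `s ∉ Z ⊆ U`,
`P(Q^U_C ∩ R^U_{W ∪ Z}) = ∑_ω weight p ω · P(Q^{U∖Z}_C ∩ R^{U∖Z}_{W ∪ frontierC ω})`. -/
theorem prob_QEventC_inter_REventC_union (p : E → R) {arcs : E → Finset (V × V)}
    (hS : SameEnds arcs) {U Z : Finset V} (hZU : Z ⊆ U) {s : V} (hsZ : s ∉ Z) (C W : Finset V) :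
    prob p (QEventC arcs U s C ∩ REventC arcs U s (W ∪ Z)) =
      ∑ ω, weight p ω *
        prob p (QEventC arcs (U \ Z) s C ∩ REventC arcs (U \ Z) s (W ∪ frontierC arcs U Z ω)) := by
  rw [QEventC_inter_REventC_union_eq hS hZU hsZ C W]
  exact prob_tower p (disjoint_intoC_withinC_sdiff arcs U Z) (dependsOn_frontierC arcs U Z)
    fun T => dependsOn_inter_same (dependsOn_QEventC arcs (U \ Z) s C)
      (dependsOn_REventC arcs (U \ Z) s (W ∪ T))

end Tower

end Summit.Ventures.PercRepro2.Coin
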